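import Literature.Barriers.CriticalPhenomena.PlaquetteWalkHoleRootRowOnly
import Literature.Barriers.CriticalPhenomena.PlaquetteWalkHoleRootRowLawWitness
import HarnessLib

/-!
# Barrier catalogue (SAWScalingLimit): the excursion of a WOUND walk from the hole root comes back to the ROOT ROW FROM BELOW, east of the hole and beyond
its own prefix run («THE EXCURSION MEETS THE EASTERN RAY») — and, in the HOLE COLUMN at level `7`, down a whole LOOP COLUMN to a bottom-row turn

`Z → ∞` limit model of the printed Yang–Baxter weights [GlazmanManolescu2019, §1, eq. (1)]; the «RECTANGLE COEFFICIENT» line (b-engine-1 g28). The even–odd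
rule [CourantRobbins1958, Ch. V App. §2] in the tree (`ΩG.AJ_root_ne_zero_iff_odd_rayCountAt`, `ΩG.rayCountAt_holeFaceW_E_eq_card_root`) says that a class-`B2a`
walk from the hole root `w.side W` is WOUND (`A_J(mid a) ≠ 0`) iff its excursion `J` (the mid-edges after the first hit of the rhombus) meets the eastern ray of the
hole — the `S` sides of the root-row plaquettes `(k, w.2)`, `k ≥ w.1` — an odd number of times. §1 unpacks the existence half into plaquette language; §2 applies it
in the setting of `PlaquetteWalkHoleRootHoleColumnDescent` (third structural step of the HOLE-COLUMN programme, FINDING-YB-HOLE-COLUMN-FOUR-PHASE, DESIGN-next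
b-engine-1 g28 §6 (a1)–(a3)):

* ★★ `ΩG.exists_tail_nth_on_eastRay`: some excursion mid-edge `nth i`, `F < i ≤ n`, is a ray mid-edge `slant k w.2`, `k ≥ w.1`.
* ★★ `ΩG.exists_tail_arc_rootRow_S`: for a rhombus WEST of the root column (`r.1 < w.1`; the hole column and everything west of it) some excursion ARC
  (`F < i < n`) lies in a root-row plaquette `(k, w.2)`, `k ≥ w.1`, and uses its `S` side — the walk comes back to the root row from below, east of the hole.
* ★★ `ΩG.exists_tail_arc_rootRow_S_beyond_prefix`: that plaquette lies at or east of the end of any straight prefix run `w, w + (1,0), …` (a plaquette crossed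
  straight is crossed once: `YBWalk.not_straight_of_two_arcs`), i.e. at or east of the first turning plaquette.
* ★★★ `ΩG.loopColumn_of_cost_seven_straight_holeColumn_above` (§2): for a wound class-`B2a` walk of limit cost `7`, slanted end, straight first arc at a hole-column
  rhombus strictly above the hole, some arc above its row: there are a column `k ≥ w.1 + k₁` (`k₁` = the index of the first turning arc) and the bottom row `Y'` such
  that an excursion arc lies in `(k, w.2)` using its `S` side, every `(k, y)`, `Y' < y < w.2`, is crossed vertically, and `(k, Y')` is an isolated bottom-row turn using
  `N` — the seven isolated turns being the two top, the two bottom, the root-row turn and the two ends of the horizontal chains of `r`, the `S`-chain of `(k, w.2)` can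
  only end at a bottom one.

[GlazmanManolescu2019 §1 Fig. 1, eq. (1), Lemma 2.1, Remark 2.2; Glazman2015WeightedSAW Lemma 3.1 (proof, pp. 6–7); CourantRobbins1958 Ch. V App. §2 (the even–odd rule)]
-/

noncomputable section

namespace Literature.Probability.RandomPlanarGeometry.SAW.YangBaxter

open Real
open Literature.Barriers.CriticalPhenomena.PlaquetteWalk

open private fc_fh fh_add_Mv three_le_Mv from Literature.Probability.RandomPlanarGeometry.YangBaxterSAWGeneralDomain

namespace ΩG

variable {D : Set Face} {w r : Face} {ω : ΩG D (w.side .W) r}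

/-- ★★ **THE EXCURSION OF A WOUND WALK MEETS THE EASTERN RAY.** For a class-`B2a` walk from the hole root `w.side W` with `A_J(mid a) ≠ 0`, some excursion
mid-edge `nth i` with `F < i ≤ n` is a mid-edge `slant k w.2`, `k ≥ w.1`, of the eastern ray of the hole (the odd ray count is not zero).
[cite: CourantRobbins1958, Ch. V Appendix §2 (The Jordan Curve Theorem for Polygons: the even–odd rule)] [cite: GlazmanManolescu2019, Lemma 2.1] -/
theorem exists_tail_nth_on_eastRay (hr : RootedFace D (w.side .W) r) (h : ω.IsB2a) (hA : ω.AJ hr h (toC (midPt (w.side .W))) ≠ 0) :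
    ∃ i, ω.2.firstHitG < i ∧ i ≤ ω.2.arcs.length ∧ ∃ k : ℤ, w.1 ≤ k ∧ ω.2.nth i = .slant k w.2 := by
  classical
  have hodd := (ω.AJ_root_ne_zero_iff_odd_rayCountAt (hr := hr) h (holeFaceW_side_E w)).1 hA
  rw [rayCountAt_holeFaceW_E_eq_card_root ω hr h] at hodd
  have hne : ((Finset.range ω.Mv).filter fun j => eastRayB w (ω.2.nth (ω.2.firstHitG + j + 1)) = true).Nonempty := by
    rw [Finset.nonempty_iff_ne_empty]
    intro he
    rw [he, Finset.card_empty] at hodd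
    exact absurd hodd (by decide)
  obtain ⟨j, hj⟩ := hne
  rw [Finset.mem_filter, Finset.mem_range] at hj
  obtain ⟨hjM, htrue⟩ := hj
  have hMv : ω.2.firstHitG + ω.Mv = ω.2.arcs.length := fh_add_Mv h
  refine ⟨ω.2.firstHitG + j + 1, by omega, by omega, ?_⟩
  generalize he : ω.2.nth (ω.2.firstHitG + j + 1) = e at htrue
  cases e with
  | slant k y =>
    simp only [eastRayB, decide_eq_true_eq] at htrue
    obtain ⟨hy, hk⟩ := htrue
    exact ⟨k, hk, by rw [hy]⟩
  | vert k y => simp [eastRayB] at htrue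

/-- ★★ **A WOUND WALK TO A WESTERN RHOMBUS COMES BACK TO THE ROOT ROW FROM BELOW, EAST OF THE HOLE.** For a class-`B2a` walk from the hole root to a rhombus
`r` west of the root column (`r.1 < w.1`) with `A_J(mid a) ≠ 0`, some excursion arc — index `i` with `F < i < n` — lies in a root-row plaquette `(k, w.2)` with
`k ≥ w.1` and uses its `S` side. [cite: CourantRobbins1958, Ch. V Appendix §2 (the even–odd rule)] [cite: GlazmanManolescu2019, §1, Fig. 1; Lemma 2.1] -/
theorem exists_tail_arc_rootRow_S (hr : RootedFace D (w.side .W) r) (h : ω.IsB2a) (hA : ω.AJ hr h (toC (midPt (w.side .W))) ≠ 0) (hw : r.1 < w.1) :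
    ∃ i, ω.2.firstHitG < i ∧ i < ω.2.arcs.length ∧ w.1 ≤ (ω.2.fc i).1 ∧ (ω.2.fc i).2 = w.2 ∧ (ω.2.sIn i = .S ∨ ω.2.sOut i = .S) := by
  obtain ⟨i, hFi, hin, k, hk, he⟩ := exists_tail_nth_on_eastRay hr h hA
  have hfcF := (fc_fh ω hr h).1
  rcases Nat.lt_or_eq_of_le hin with hlt | heq
  · -- the arc `i` enters through `nth i`
    obtain ⟨hsi, -⟩ := ω.2.side_sIn_eq_nth hlt
    rw [he] at hsi
    rcases eq_of_side_eq_slant hsi with ⟨hf, hs⟩ | ⟨hf, hs⟩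
    · exact ⟨i, hFi, hlt, by rw [hf]; exact hk, by rw [hf], Or.inl hs⟩
    · -- the arc `i` lies below the ray and enters from `N`: the arc `i - 1` leaves `(k, w.2)` through `S`
      obtain ⟨-, hso⟩ := ω.2.side_sIn_eq_nth (i := i - 1) (by omega)
      rw [show i - 1 + 1 = i by omega, he] at hso
      rcases eq_of_side_eq_slant hso with ⟨hf', hs'⟩ | ⟨hf', -⟩
      · refine ⟨i - 1, ?_, by omega, by rw [hf']; exact hk, by rw [hf'], Or.inr hs'⟩
        rcases Nat.lt_or_ge ω.2.firstHitG (i - 1) with h1 | h1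
        · exact h1
        · exfalso
          have e : i - 1 = ω.2.firstHitG := by omega
          rw [e, hfcF] at hf'
          have := congrArg Prod.fst hf'
          simp only at this
          omega
      · exfalso
        exact ω.2.fc_succ_ne (i := i - 1) (by rw [show i - 1 + 1 = i by omega]; exact hlt) (by rw [hf', show i - 1 + 1 = i by omega, hf])
  · -- `i = n`: the end side of `r` is west of the ray
    exfalso
    rw [heq, ω.2.nth_length] at he
    rcases eq_of_side_eq_slant he with ⟨hf, -⟩ | ⟨hf, -⟩
    · have := congrArg Prod.fst hf; simp only at this; omega
    · have := congrArg Prod.fst hf; simp only at this; omega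

/-- ★★ **… AND BEYOND THE PREFIX RUN.** In the situation of `exists_tail_arc_rootRow_S` with the hole `(w.1 − 1, w.2)` absent, if the first `k₁` arcs are straight
(so that, by `YBWalk.initial_run`, they cross `w, w + (1,0), …, w + (k₁ − 1, 0)` straight to the east), the root-row plaquette met by the excursion from below lies at or
east of `(w.1 + k₁, w.2)`: a plaquette crossed straight carries no second arc (`YBWalk.not_straight_of_two_arcs`). [cite: CourantRobbins1958, Ch. V Appendix §2 (the
even–odd rule)] [cite: GlazmanManolescu2019, §1, Fig. 1 (the five plaquette configurations); Lemma 2.1] -/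
theorem exists_tail_arc_rootRow_S_beyond_prefix (hh : holeFaceW w ∉ D) (hr : RootedFace D (w.side .W) r) (h : ω.IsB2a)
    (hA : ω.AJ hr h (toC (midPt (w.side .W))) ≠ 0) (hw : r.1 < w.1) {k₁ : ℕ} (hk₁ : k₁ ≤ ω.2.firstHitG)
    (hstr : ∀ i < k₁, arcKind (ω.2.sIn i) (ω.2.sOut i) = .straight) :
    ∃ i, ω.2.firstHitG < i ∧ i < ω.2.arcs.length ∧ w.1 + k₁ ≤ (ω.2.fc i).1 ∧ (ω.2.fc i).2 = w.2 ∧ (ω.2.sIn i = .S ∨ ω.2.sOut i = .S) := by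
  obtain ⟨i, hFi, hin, hk, hrow, hS⟩ := exists_tail_arc_rootRow_S hr h hA hw
  refine ⟨i, hFi, hin, ?_, hrow, hS⟩
  by_contra hlt
  push Not at hlt
  have hF := ω.fh_lt h
  -- the plaquette `fc i = (w.1 + m, w.2)` with `m < k₁` is crossed straight by the prefix arc `m`
  obtain ⟨m, hm⟩ : ∃ m : ℕ, (m : ℤ) = (ω.2.fc i).1 - w.1 := ⟨((ω.2.fc i).1 - w.1).toNat, by omega⟩
  have hmk : m < k₁ := by omega
  obtain ⟨hrun, -⟩ := ω.2.initial_run hh (show k₁ < ω.2.arcs.length by omega) hstr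
  have hfm : ω.2.fc m = ω.2.fc i := by
    rw [(hrun m hmk.le).1]
    exact Prod.ext (by simp only; omega) (by simp only; omega)
  obtain ⟨hns, -⟩ := YBWalk.not_straight_of_two_arcs (γ := ω.2) (i := m) (i' := i) (by omega) hin (by omega) hfm.symm
  have hsm := hstr m hmk
  have key : ∀ s t : Side, arcKind s t = .straight → t = s.opp := by intro s t; cases s <;> cases t <;> decide
  exact hns (key _ _ hsm)

/-- ★★★ **HOLE COLUMN: THE LOOP COLUMN.** Let `ω` be a wound class-`B2a` walk of limit cost `7` from the hole root `w.side W` (hole `(w.1 − 1, w.2)` absent) with a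
slanted end and a STRAIGHT first arc at a rhombus `r` of the hole column (`r.1 = w.1 − 1`) strictly above the hole, some arc of `ω` lying strictly above the row of `r`.
Then for some column `k` at or east of the first turning plaquette `(w.1 + k₁, w.2)` of the walk and the walk's bottom row `Y' < w.2`: an excursion arc (index
`F < i < n`) lies in `(k, w.2)` and uses its `S` side; the plaquettes `(k, w.2 − m)`, `1 ≤ m ≤ w.2 − Y'`, use `N` and those with `m < w.2 − Y'` use `S`; and `(k, Y')`
does not use `S` and carries exactly one arc, a turning one (an isolated bottom-row turn). [cite: GlazmanManolescu2019, §1, Fig. 1 and eq. (1); Lemma 2.1; Remark 2.2]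
[cite: Glazman2015WeightedSAW, Lemma 3.1 (proof, pp. 6–7)] [cite: CourantRobbins1958, Ch. V Appendix §2 (the even–odd rule)] -/
theorem loopColumn_of_cost_seven_straight_holeColumn_above (hh : holeFaceW w ∉ D) (hr : RootedFace D (w.side .W) r) (h : ω.IsB2a)
    (hA : ω.AJ hr h (toC (midPt (w.side .W))) ≠ 0) (hc : cost (slotOfSide ω.1) ω.2.mids = 7) (hz : ω.1 = .N ∨ ω.1 = .S)
    (hstr8 : arcKind (ω.2.sIn ω.2.firstHitG) (ω.2.sOut ω.2.firstHitG) = .straight) (hcol : r.1 = w.1 - 1) (habove : w.2 < r.2)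
    (hup : ∃ j < ω.2.arcs.length, r.2 < (ω.2.fc j).2) :
    ∃ k Y' : ℤ, (∃ k₁ : ℕ, k₁ ≤ ω.2.firstHitG ∧ (∀ i < k₁, arcKind (ω.2.sIn i) (ω.2.sOut i) = .straight) ∧
        arcKind (ω.2.sIn k₁) (ω.2.sOut k₁) ≠ .straight ∧ w.1 + k₁ ≤ k) ∧
      (∀ j < ω.2.arcs.length, Y' ≤ (ω.2.fc j).2) ∧ Y' < w.2 ∧
      (∃ i, ω.2.firstHitG < i ∧ i < ω.2.arcs.length ∧ ω.2.fc i = (k, w.2) ∧ (ω.2.sIn i = .S ∨ ω.2.sOut i = .S)) ∧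
      (∀ m : ℕ, 1 ≤ m → (m : ℤ) ≤ w.2 - Y' → ω.2.UsesSide (k, w.2 - m) .N) ∧
      (∀ m : ℕ, (m : ℤ) < w.2 - Y' → ω.2.UsesSide (k, w.2 - m) .S) ∧
      ¬ω.2.UsesSide (k, Y') .S ∧
      (∃ i' < ω.2.arcs.length, ω.2.fc i' = (k, Y') ∧ (∀ l < ω.2.arcs.length, ω.2.fc l = ω.2.fc i' → l = i') ∧
        arcKind (ω.2.sIn i') (ω.2.sOut i') ≠ .straight) := by
  classical
  set n := ω.2.arcs.length with hn
  ---------------------------------------------------------------- basics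
  have hF := ω.fh_lt h
  have hlen : 0 < n := by omega
  have h0w : ω.2.fc 0 = w := fc_zero_eq_root w hh ω.2 hlen
  have h0W : ω.2.sIn 0 = .W := YBWalk.sIn_zero_eq_W hh ω.2 hlen
  have h0E : ω.2.sIn 0 ≠ .E := by rw [h0W]; decide
  have h0N : ω.2.sIn 0 ≠ .N := by rw [h0W]; decide
  have h0S : ω.2.sIn 0 ≠ .S := by rw [h0W]; decide
  have hfcF := (fc_fh ω hr h).1
  have hsvr : ∀ l < n, ω.2.fc l = ω.2.fc ω.2.firstHitG → l = ω.2.firstHitG := fun l hl e => eq_firstHitG_of_fc_eq hr h hl e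
  have hfne3 : ω.2.firstHitG + 3 ≤ n := by have := three_le_Mv hr h; have := fh_add_Mv h; unfold ΩG.Mv at *; omega
  have hn1 : n - 1 < n := by omega
  have hlast := sOut_last_NS_of_slanted h hz
  have hzE : ω.2.sOut (n - 1) ≠ .E := by rcases hlast with e | e <;> rw [e] <;> decide
  have hzW : ω.2.sOut (n - 1) ≠ .W := by rcases hlast with e | e <;> rw [e] <;> decide
  have hlastr := fc_last_ne_root hr h
  have hLD : ω.2.fc (n - 1) ∈ D := (YBWalk.arcFace_arcAt hn1).2
  have hmemD : ∀ {c : Face} {s : Side}, ω.2.UsesSide c s → c ∈ D := by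
    intro c s hu
    obtain ⟨j, hj, hfj⟩ := ω.2.exists_fc_eq_of_usesSide hu
    rw [← hfj]; exact (YBWalk.arcFace_arcAt hj).2
  have hnotD : ∀ {c : Face}, c ∈ D → c = holeFaceW w → False := fun hc e => hh (e ▸ hc)
  have hzside : (ω.2.fc (n - 1)).side (ω.2.sOut (n - 1)) = r.side ω.1 := by
    obtain ⟨-, hout⟩ := ω.2.side_sIn_eq_nth hn1
    rwa [show n - 1 + 1 = n by omega, ω.2.nth_length] at hout
  -- the side of `r` carrying the end is not used by the arc of `r`
  have hrside : ∀ s, ω.2.UsesSide r s → r.side s ≠ r.side ω.1 := by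
    rintro s ⟨l, hl, hfl, hs⟩ e
    have hl' := hsvr l hl (hfl.trans hfcF.symm)
    obtain ⟨hin, hout⟩ := ω.2.side_sIn_eq_nth hl
    rw [hfl] at hin hout
    rw [← ω.2.nth_length] at e
    rcases hs with hs | hs
    · rw [hs] at hin; have := ω.2.nth_inj (show l ≤ n by omega) le_rfl (hin.symm.trans e).symm.symm; omega
    · rw [hs] at hout; have := ω.2.nth_inj (show l + 1 ≤ n by omega) le_rfl (hout.symm.trans e).symm.symm; omega
  -- the last plaquette: `ω.1 = N`: `L = (r.1, r.2 + 1)`, left through `S`; `ω.1 = S`: `L = (r.1, r.2 − 1)`, left through `N`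
  have hLcases : (ω.1 = .N ∧ ω.2.sOut (n - 1) = .S ∧ ω.2.fc (n - 1) = (r.1, r.2 + 1)) ∨
      (ω.1 = .S ∧ ω.2.sOut (n - 1) = .N ∧ ω.2.fc (n - 1) = (r.1, r.2 - 1)) := by
    rcases hfc : ω.2.fc (n - 1) with ⟨x, y⟩
    rw [hfc] at hzside hlastr
    rcases r with ⟨r1, r2⟩
    simp only at hlastr ⊢
    generalize hs : ω.2.sOut (n - 1) = s at hzside hlast ⊢
    generalize ht : ω.1 = t at hzside hz ⊢
    rcases hz with rfl | rfl <;> rcases hlast with rfl | rfl <;>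
      simp only [Face.side, MidEdge.slant.injEq, Prod.mk.injEq, reduceCtorEq, false_and, and_false, true_and, false_or, or_false] at hzside ⊢
    · exact absurd (Prod.ext hzside.1 (by simp only; omega)) hlastr
    · refine ⟨?_, ?_⟩ <;> omega
    · refine ⟨?_, ?_⟩ <;> omega
    · exact absurd (Prod.ext hzside.1 (by simp only; omega)) hlastr
  ---------------------------------------------------------------- isolated turns: seven, as `P`-cells
  have h7 : cfgCount ω.2.mids [.corner] + cfgCount ω.2.mids [.coCorner] = 7 := by
    have hcost : cost (slotOfSide ω.1) ω.2.mids =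
        cfgCount ω.2.mids [.corner] + cfgCount ω.2.mids [.coCorner] + (1 - slotDeg (slotOfSide ω.1)) := rfl
    have hd : slotDeg (slotOfSide ω.1) = 1 := by rcases hz with e | e <;> rw [e] <;> rfl
    rw [hcost, hd] at hc; omega
  let P : Face → Prop := fun f => f ∈ facesL ω.2.mids ∧ (kindsL ω.2.mids f = [.corner] ∨ kindsL ω.2.mids f = [.coCorner])
  have hPiso : ∀ k < n, (∀ l < n, ω.2.fc l = ω.2.fc k → l = k) → arcKind (ω.2.sIn k) (ω.2.sOut k) ≠ .straight → P (ω.2.fc k) :=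
    fun k hk hsv hkind => isolated_turn hk hsv hkind
  have hle7 : ∀ T : Finset Face, (∀ f ∈ T, P f) → T.card ≤ 7 := by
    intro T hT; have := YBWalk.card_le_cfgCount_add ω.2.mids T hT; omega
  -- top and bottom turns
  obtain ⟨Y, hYw, hY, Tt, hTtP, hTtrow, hTtcard⟩ := two_top_turns hh hr h hA
  have hTt2 : 1 < Tt.card := by
    rcases hTtcard with h2 | ⟨-, hzv, -⟩
    · omega
    · exfalso; rcases hz with e | e <;> rcases hzv with e' | e' <;> rw [e] at e' <;> exact absurd e' (by decide)
  obtain ⟨t₁, ht₁, t₂, ht₂, ht12⟩ := Finset.one_lt_card.1 hTt2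
  have hPt₁ : P t₁ := hTtP t₁ ht₁
  have hPt₂ : P t₂ := hTtP t₂ ht₂
  have ht₁row : t₁.2 = Y := hTtrow t₁ ht₁
  have ht₂row : t₂.2 = Y := hTtrow t₂ ht₂
  obtain ⟨Y', hY'w, hY', Tb, hTbP, hTbrow, hTbcard⟩ := two_bottom_turns hh hr h hA
  have hTb2 : 1 < Tb.card := by
    rcases hTbcard with h2 | ⟨-, hzv, -⟩
    · omega
    · exfalso; rcases hz with e | e <;> rcases hzv with e' | e' <;> rw [e] at e' <;> exact absurd e' (by decide)
  obtain ⟨b₁, hb₁, b₂, hb₂, hb12⟩ := Finset.one_lt_card.1 hTb2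
  have hPb₁ : P b₁ := hTbP b₁ hb₁
  have hPb₂ : P b₂ := hTbP b₂ hb₂
  have hb₁row : b₁.2 = Y' := hTbrow b₁ hb₁
  have hb₂row : b₂.2 = Y' := hTbrow b₂ hb₂
  have hNtop := forall_top_ne_N hh hr h hY (by omega)
  obtain ⟨X', -, hX', -⟩ := exists_right_entry_turn hh hr h
  obtain ⟨X, hXw, hX, -⟩ := exists_left_entry_turn hh hr h hA
  have hrY : r.2 ≤ Y := by have := hY _ hF; rwa [hfcF] at this
  ---------------------------------------------------------------- the first turn and the root-row turn `τ = (τ1, w.2)`, `τ1 ≥ w.1`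
  have hexk : ∃ k, k < n ∧ arcKind (ω.2.sIn k) (ω.2.sOut k) ≠ .straight := by
    by_contra hnone
    push Not at hnone
    obtain ⟨hrun0, -⟩ := ω.2.initial_run hh hF (fun i hi => hnone i (by omega))
    have e := (hrun0 ω.2.firstHitG le_rfl).1
    rw [hfcF] at e
    have := congrArg Prod.snd e; simp only at this; omega
  obtain ⟨hk₁, hk₁ns⟩ := Nat.find_spec hexk
  set k₁ := Nat.find hexk with hk₁def
  have hstr : ∀ i < k₁, arcKind (ω.2.sIn i) (ω.2.sOut i) = .straight := by
    intro i hi; by_contra hne; exact Nat.find_min hexk hi ⟨by omega, hne⟩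
  obtain ⟨hrun, -⟩ := ω.2.initial_run hh hk₁ hstr
  obtain ⟨hfk, hWk⟩ := hrun k₁ le_rfl
  have hp₁W : ω.2.UsesSide (w.1 + k₁, w.2) .W := ⟨k₁, hk₁, hfk, Or.inl hWk⟩
  obtain ⟨τ1, hPτ, hτ1w⟩ : ∃ τ1 : ℤ, P (τ1, w.2) ∧ w.1 + k₁ ≤ τ1 := by
    by_cases hpE : ω.2.UsesSide (w.1 + k₁, w.2) .E
    · obtain ⟨M, hWall, -, hend⟩ := ω.2.chain_E hX' hpE
      rcases hend with ⟨hM1, hnot⟩ | ⟨-, hs0⟩ | ⟨-, hsZ⟩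
      · obtain ⟨i', hi', hfc', hsv', -, -, -, hk'⟩ := ω.2.isolated_of_usesSide_not_opp (hWall M hM1 le_rfl) hnot
        refine ⟨w.1 + k₁ + M, ?_, by omega⟩
        have := hPiso i' hi' hsv' hk'; rw [hfc'] at this; exact this
      · exact absurd hs0 h0E
      · exact absurd hsZ hzE
    · obtain ⟨i', hi', hfc', hsv', -, -, -, hk'⟩ := ω.2.isolated_of_usesSide_not_opp hp₁W hpE
      refine ⟨w.1 + k₁, ?_, le_rfl⟩
      have := hPiso i' hi' hsv' hk'; rw [hfc'] at this; exact this
  -- `r` is not in the top row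
  have hrtop : r.2 ≠ Y := by
    obtain ⟨j, hj, hjr⟩ := hup
    have := hY j hj
    omega
  have hr₂ : Y' < r.2 := by omega
  have hr₃ : r.2 < Y := lt_of_le_of_ne hrY hrtop
  ---------------------------------------------------------------- the arc of `r` is horizontal: `r` uses `W` and `E`; the ends `e_W`, `e_E` of its chains are isolated turns on the row of `r`
  have hrWE : ω.2.UsesSide r .W ∧ ω.2.UsesSide r .E := by
    have hne := ω.2.sIn_ne_sOut hF
    have hnoz : ¬(ω.2.sIn ω.2.firstHitG = ω.1 ∨ ω.2.sOut ω.2.firstHitG = ω.1) := fun hs => hrside ω.1 ⟨_, hF, hfcF, hs⟩ rfl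
    have key : ∀ t : Side, (t = .N ∨ t = .S) → ¬(ω.2.sIn ω.2.firstHitG = t ∨ ω.2.sOut ω.2.firstHitG = t) →
        arcKind (ω.2.sIn ω.2.firstHitG) (ω.2.sOut ω.2.firstHitG) = .straight → ω.2.sIn ω.2.firstHitG ≠ ω.2.sOut ω.2.firstHitG →
        (ω.2.sIn ω.2.firstHitG = .W ∨ ω.2.sOut ω.2.firstHitG = .W) ∧ (ω.2.sIn ω.2.firstHitG = .E ∨ ω.2.sOut ω.2.firstHitG = .E) := by
      intro t ht
      cases ω.2.sIn ω.2.firstHitG <;> cases ω.2.sOut ω.2.firstHitG <;> rcases ht with rfl | rfl <;> decide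
    obtain ⟨hW, hE⟩ := key ω.1 hz hnoz hstr8 hne
    exact ⟨⟨_, hF, hfcF, hW⟩, ⟨_, hF, hfcF, hE⟩⟩
  obtain ⟨hrW, hrE⟩ := hrWE
  obtain ⟨MW, hEW, -, hendW⟩ := ω.2.chain_W hX hrW
  obtain ⟨hMW1, hPeW⟩ : 1 ≤ MW ∧ P (r.1 - MW, r.2) := by
    rcases hendW with ⟨hM1, hnot⟩ | ⟨hA0, -⟩ | ⟨-, hsZ⟩
    · obtain ⟨i', hi', hfc', hsv', -, -, -, hk'⟩ := ω.2.isolated_of_usesSide_not_opp (hEW MW hM1 le_rfl) hnot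
      refine ⟨hM1, ?_⟩
      have := hPiso i' hi' hsv' hk'; rw [hfc'] at this; exact this
    · exfalso; rw [h0w] at hA0; have := congrArg Prod.snd hA0; simp only at this; omega
    · exact absurd hsZ hzW
  obtain ⟨ME, hWE, -, hendE⟩ := ω.2.chain_E hX' hrE
  obtain ⟨hME1, hPeE⟩ : 1 ≤ ME ∧ P (r.1 + ME, r.2) := by
    rcases hendE with ⟨hM1, hnot⟩ | ⟨-, hs0⟩ | ⟨-, hsZ⟩
    · obtain ⟨i', hi', hfc', hsv', -, -, -, hk'⟩ := ω.2.isolated_of_usesSide_not_opp (hWE ME hM1 le_rfl) hnot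
      refine ⟨hM1, ?_⟩
      have := hPiso i' hi' hsv' hk'; rw [hfc'] at this; exact this
    · exact absurd hs0 h0E
    · exact absurd hsZ hzE
  ---------------------------------------------------------------- an eighth isolated turn strictly between the extreme rows, off the root row and off the row of `r`, is impossible
  have hne_of_row : ∀ f g : Face, f.2 ≠ g.2 → f ≠ g := fun f g hfg e => hfg (by rw [e])
  have houts1 : ∀ g : Face, P g → Y' < g.2 → g.2 < Y → g.2 ≠ w.2 → g.2 ≠ r.2 → False := by
    intro g hPg a1 a2 a3 a4
    have n1 : g ≠ t₁ := hne_of_row _ _ (by rw [ht₁row]; omega)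
    have n2 : g ≠ t₂ := hne_of_row _ _ (by rw [ht₂row]; omega)
    have n3 : g ≠ b₁ := hne_of_row _ _ (by rw [hb₁row]; omega)
    have n4 : g ≠ b₂ := hne_of_row _ _ (by rw [hb₂row]; omega)
    have n5 : g ≠ ((τ1 : ℤ), w.2) := hne_of_row _ _ (by simp only; exact a3)
    have n6 : g ≠ ((r.1 : ℤ) - MW, r.2) := hne_of_row _ _ (by simp only; exact a4)
    have n7 : g ≠ ((r.1 : ℤ) + ME, r.2) := hne_of_row _ _ (by simp only; exact a4)
    have h01 : t₁ ≠ t₂ := ht12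
    have h02 : t₁ ≠ b₁ := hne_of_row _ _ (by rw [ht₁row, hb₁row]; omega)
    have h03 : t₁ ≠ b₂ := hne_of_row _ _ (by rw [ht₁row, hb₂row]; omega)
    have h04 : t₁ ≠ ((τ1 : ℤ), w.2) := hne_of_row _ _ (by rw [ht₁row]; simp only; omega)
    have h05 : t₁ ≠ ((r.1 : ℤ) - MW, r.2) := hne_of_row _ _ (by rw [ht₁row]; simp only; omega)
    have h06 : t₁ ≠ ((r.1 : ℤ) + ME, r.2) := hne_of_row _ _ (by rw [ht₁row]; simp only; omega)
    have h12 : t₂ ≠ b₁ := hne_of_row _ _ (by rw [ht₂row, hb₁row]; omega)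
    have h13 : t₂ ≠ b₂ := hne_of_row _ _ (by rw [ht₂row, hb₂row]; omega)
    have h14 : t₂ ≠ ((τ1 : ℤ), w.2) := hne_of_row _ _ (by rw [ht₂row]; simp only; omega)
    have h15 : t₂ ≠ ((r.1 : ℤ) - MW, r.2) := hne_of_row _ _ (by rw [ht₂row]; simp only; omega)
    have h16 : t₂ ≠ ((r.1 : ℤ) + ME, r.2) := hne_of_row _ _ (by rw [ht₂row]; simp only; omega)
    have h23 : b₁ ≠ b₂ := hb12
    have h24 : b₁ ≠ ((τ1 : ℤ), w.2) := hne_of_row _ _ (by rw [hb₁row]; simp only; omega)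
    have h25 : b₁ ≠ ((r.1 : ℤ) - MW, r.2) := hne_of_row _ _ (by rw [hb₁row]; simp only; omega)
    have h26 : b₁ ≠ ((r.1 : ℤ) + ME, r.2) := hne_of_row _ _ (by rw [hb₁row]; simp only; omega)
    have h34 : b₂ ≠ ((τ1 : ℤ), w.2) := hne_of_row _ _ (by rw [hb₂row]; simp only; omega)
    have h35 : b₂ ≠ ((r.1 : ℤ) - MW, r.2) := hne_of_row _ _ (by rw [hb₂row]; simp only; omega)
    have h36 : b₂ ≠ ((r.1 : ℤ) + ME, r.2) := hne_of_row _ _ (by rw [hb₂row]; simp only; omega)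
    have h45 : ((τ1 : ℤ), w.2) ≠ ((r.1 : ℤ) - MW, r.2) := hne_of_row _ _ (by simp only; omega)
    have h46 : ((τ1 : ℤ), w.2) ≠ ((r.1 : ℤ) + ME, r.2) := hne_of_row _ _ (by simp only; omega)
    have h56 : ((r.1 : ℤ) - MW, r.2) ≠ ((r.1 : ℤ) + ME, r.2) := by intro e; have := congrArg Prod.fst e; simp only at this; omega
    have hT : ∀ f ∈ ({g, t₁, t₂, b₁, b₂, ((τ1 : ℤ), w.2), ((r.1 : ℤ) - MW, r.2), ((r.1 : ℤ) + ME, r.2)} : Finset Face), P f := by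
      intro f hf
      simp only [Finset.mem_insert, Finset.mem_singleton] at hf
      rcases hf with rfl | rfl | rfl | rfl | rfl | rfl | rfl | rfl
      exacts [hPg, hPt₁, hPt₂, hPb₁, hPb₂, hPτ, hPeW, hPeE]
    have hcard : ({g, t₁, t₂, b₁, b₂, ((τ1 : ℤ), w.2), ((r.1 : ℤ) - MW, r.2), ((r.1 : ℤ) + ME, r.2)} : Finset Face).card = 8 := by
      rw [Finset.card_insert_of_notMem (by simp only [Finset.mem_insert, Finset.mem_singleton, not_or]; exact ⟨n1, n2, n3, n4, n5, n6, n7⟩),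
        Finset.card_insert_of_notMem (by simp only [Finset.mem_insert, Finset.mem_singleton, not_or]; exact ⟨h01, h02, h03, h04, h05, h06⟩),
        Finset.card_insert_of_notMem (by simp only [Finset.mem_insert, Finset.mem_singleton, not_or]; exact ⟨h12, h13, h14, h15, h16⟩),
        Finset.card_insert_of_notMem (by simp only [Finset.mem_insert, Finset.mem_singleton, not_or]; exact ⟨h23, h24, h25, h26⟩),
        Finset.card_insert_of_notMem (by simp only [Finset.mem_insert, Finset.mem_singleton, not_or]; exact ⟨h34, h35, h36⟩),
        Finset.card_insert_of_notMem (by simp only [Finset.mem_insert, Finset.mem_singleton, not_or]; exact ⟨h45, h46⟩),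
        Finset.card_insert_of_notMem (by simp only [Finset.mem_singleton]; exact h56), Finset.card_singleton]
    have := hle7 _ hT
    omega
  ---------------------------------------------------------------- the excursion meets the eastern ray at or east of the first turning plaquette
  have hk₁F : k₁ ≤ ω.2.firstHitG := by
    by_contra hlt
    push Not at hlt
    obtain ⟨hrun0, -⟩ := ω.2.initial_run hh hF (fun i hi => hstr i (by omega))
    have e := (hrun0 ω.2.firstHitG le_rfl).1
    rw [hfcF] at e
    have := congrArg Prod.snd e; simp only at this; omega
  have hwr : r.1 < w.1 := by omega
  obtain ⟨i, hFi, hin, hki, hrow, hS⟩ := exists_tail_arc_rootRow_S_beyond_prefix hh hr h hA hwr hk₁F hstr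
  have hqS : ω.2.UsesSide (ω.2.fc i) .S := ⟨i, hin, rfl, hS⟩
  obtain ⟨M, hNall, hSall, hend⟩ := ω.2.chain_S hY' hqS
  rw [hrow] at hNall hSall hend
  ---------------------------------------------------------------- its `S`-chain ends at a bottom-row turn
  have hwY : w.2 < Y := by omega
  obtain ⟨hM, i', hi', hfc', hsv', hk', hnot⟩ : (M : ℤ) = w.2 - Y' ∧ ∃ i' < n, ω.2.fc i' = ((ω.2.fc i).1, w.2 - M) ∧
      (∀ l < n, ω.2.fc l = ω.2.fc i' → l = i') ∧ arcKind (ω.2.sIn i') (ω.2.sOut i') ≠ .straight ∧ ¬ω.2.UsesSide ((ω.2.fc i).1, w.2 - M) .S := by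
    rcases hend with ⟨hM1, hnot⟩ | ⟨hZ0, hs0⟩ | ⟨hZ, hsZ⟩
    · obtain ⟨i', hi', hfc', hsv', -, -, -, hk'⟩ := ω.2.isolated_of_usesSide_not_opp (hNall M hM1 le_rfl) hnot
      have hP' : P ((ω.2.fc i).1, w.2 - M) := by rw [← hfc']; exact hPiso i' hi' hsv' hk'
      have hge : Y' ≤ w.2 - M := by have := hY' i' hi'; rw [hfc'] at this; exact this
      rcases lt_or_eq_of_le hge with hlt | heq
      · exfalso
        exact houts1 _ hP' (by simp only; exact hlt) (by simp only; omega) (by simp only; omega) (by simp only; omega)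
      · exact ⟨by omega, i', hi', hfc', hsv', hk', hnot⟩
    · exact absurd hs0 h0S
    · exfalso
      rcases hLcases with ⟨-, -, hL⟩ | ⟨-, hsN, -⟩
      · rw [hL] at hZ; have := congrArg Prod.snd hZ; simp only at this; omega
      · rw [hsN] at hsZ; exact absurd hsZ (by decide)
  refine ⟨(ω.2.fc i).1, Y', ⟨k₁, hk₁F, hstr, hk₁ns, hki⟩, hY', by omega, ⟨i, hFi, hin, ?_, hS⟩, fun m hm1 hmM => hNall m hm1 (by omega),
    fun m hmM => hSall m (by omega), ?_, ⟨i', hi', ?_, hsv', hk'⟩⟩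
  · rw [← hrow]
  · have e : w.2 - (M : ℤ) = Y' := by omega
    rw [e] at hnot; exact hnot
  · rw [hfc', hM]; exact Prod.ext rfl (by simp only; omega)

/-- ★★★ **HOLE COLUMN: THE ROOT-ROW PASSAGE (trichotomy).** In the setting of `loopColumn_of_cost_seven_straight_holeColumn_above` let `p₁ = fc k₁ = (w.1 + k₁, w.2)` be the
first turning plaquette (the arcs `0, …, k₁ − 1` are straight, the arc `k₁` enters from `W` and turns) and let `q = fc i`, `F < i < n`, be the root-row plaquette at or east
of `p₁` in which an excursion arc uses the `S` side (`exists_tail_arc_rootRow_S_beyond_prefix`). Then EITHER (I) `q = p₁` is a KISS cell: the prefix turns `N` there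
(`sOut k₁ = N`) and the excursion arc is the corner through `S` and `E`; OR (II) `q` lies strictly east of `p₁`, is crossed STRAIGHT (vertically) and only once, and its
`N`-chain `(q.1, w.2 + 1), …, (q.1, w.2 + M)` climbs to an isolated turn not using `N` that lies on the row of `r` or on the top row of the walk; OR (III) `q` lies strictly
east of `p₁` and its excursion arc turns there (the residual case; absent from the lane's census, to be excluded by the frame car). [cite: GlazmanManolescu2019, §1, Fig. 1
and eq. (1); Lemma 2.1; Remark 2.2] [cite: Glazman2015WeightedSAW, Lemma 3.1 (proof, pp. 6–7)] [cite: CourantRobbins1958, Ch. V Appendix §2 (the even–odd rule)] -/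
theorem rootRowPassage_of_cost_seven_straight_holeColumn_above (hh : holeFaceW w ∉ D) (hr : RootedFace D (w.side .W) r) (h : ω.IsB2a)
    (hA : ω.AJ hr h (toC (midPt (w.side .W))) ≠ 0) (hc : cost (slotOfSide ω.1) ω.2.mids = 7) (hz : ω.1 = .N ∨ ω.1 = .S)
    (hstr8 : arcKind (ω.2.sIn ω.2.firstHitG) (ω.2.sOut ω.2.firstHitG) = .straight) (hcol : r.1 = w.1 - 1) (habove : w.2 < r.2)
    (hup : ∃ j < ω.2.arcs.length, r.2 < (ω.2.fc j).2) :
    ∃ k₁ i : ℕ, k₁ ≤ ω.2.firstHitG ∧ (∀ j < k₁, arcKind (ω.2.sIn j) (ω.2.sOut j) = .straight) ∧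
      arcKind (ω.2.sIn k₁) (ω.2.sOut k₁) ≠ .straight ∧ ω.2.fc k₁ = (w.1 + k₁, w.2) ∧ ω.2.sIn k₁ = .W ∧
      ω.2.firstHitG < i ∧ i < ω.2.arcs.length ∧ (ω.2.fc i).2 = w.2 ∧ w.1 + k₁ ≤ (ω.2.fc i).1 ∧ (ω.2.sIn i = .S ∨ ω.2.sOut i = .S) ∧
      ((ω.2.fc i = ω.2.fc k₁ ∧ ω.2.sOut k₁ = .N ∧ (ω.2.sIn i = .E ∨ ω.2.sOut i = .E)) ∨
        (w.1 + k₁ < (ω.2.fc i).1 ∧ arcKind (ω.2.sIn i) (ω.2.sOut i) = .straight ∧ (∀ l < ω.2.arcs.length, ω.2.fc l = ω.2.fc i → l = i) ∧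
          ∃ M : ℕ, 1 ≤ M ∧ (∀ m : ℕ, 1 ≤ m → m ≤ M → ω.2.UsesSide ((ω.2.fc i).1, w.2 + m) .S) ∧
            (∀ m : ℕ, m < M → ω.2.UsesSide ((ω.2.fc i).1, w.2 + m) .N) ∧ ¬ω.2.UsesSide ((ω.2.fc i).1, w.2 + M) .N ∧
            (w.2 + (M : ℤ) = r.2 ∨ ∀ j < ω.2.arcs.length, (ω.2.fc j).2 ≤ w.2 + M)) ∨
        (w.1 + k₁ < (ω.2.fc i).1 ∧ arcKind (ω.2.sIn i) (ω.2.sOut i) ≠ .straight)) := by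
  classical
  set n := ω.2.arcs.length with hn
  ---------------------------------------------------------------- basics
  have hF := ω.fh_lt h
  have hlen : 0 < n := by omega
  have h0w : ω.2.fc 0 = w := fc_zero_eq_root w hh ω.2 hlen
  have h0W : ω.2.sIn 0 = .W := YBWalk.sIn_zero_eq_W hh ω.2 hlen
  have h0E : ω.2.sIn 0 ≠ .E := by rw [h0W]; decide
  have h0N : ω.2.sIn 0 ≠ .N := by rw [h0W]; decide
  have h0S : ω.2.sIn 0 ≠ .S := by rw [h0W]; decide
  have hfcF := (fc_fh ω hr h).1
  have hsvr : ∀ l < n, ω.2.fc l = ω.2.fc ω.2.firstHitG → l = ω.2.firstHitG := fun l hl e => eq_firstHitG_of_fc_eq hr h hl e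
  have hfne3 : ω.2.firstHitG + 3 ≤ n := by have := three_le_Mv hr h; have := fh_add_Mv h; unfold ΩG.Mv at *; omega
  have hn1 : n - 1 < n := by omega
  have hlast := sOut_last_NS_of_slanted h hz
  have hzE : ω.2.sOut (n - 1) ≠ .E := by rcases hlast with e | e <;> rw [e] <;> decide
  have hzW : ω.2.sOut (n - 1) ≠ .W := by rcases hlast with e | e <;> rw [e] <;> decide
  have hlastr := fc_last_ne_root hr h
  have hLD : ω.2.fc (n - 1) ∈ D := (YBWalk.arcFace_arcAt hn1).2
  have hmemD : ∀ {c : Face} {s : Side}, ω.2.UsesSide c s → c ∈ D := by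
    intro c s hu
    obtain ⟨j, hj, hfj⟩ := ω.2.exists_fc_eq_of_usesSide hu
    rw [← hfj]; exact (YBWalk.arcFace_arcAt hj).2
  have hnotD : ∀ {c : Face}, c ∈ D → c = holeFaceW w → False := fun hc e => hh (e ▸ hc)
  have hzside : (ω.2.fc (n - 1)).side (ω.2.sOut (n - 1)) = r.side ω.1 := by
    obtain ⟨-, hout⟩ := ω.2.side_sIn_eq_nth hn1
    rwa [show n - 1 + 1 = n by omega, ω.2.nth_length] at hout
  -- the side of `r` carrying the end is not used by the arc of `r`
  have hrside : ∀ s, ω.2.UsesSide r s → r.side s ≠ r.side ω.1 := by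
    rintro s ⟨l, hl, hfl, hs⟩ e
    have hl' := hsvr l hl (hfl.trans hfcF.symm)
    obtain ⟨hin, hout⟩ := ω.2.side_sIn_eq_nth hl
    rw [hfl] at hin hout
    rw [← ω.2.nth_length] at e
    rcases hs with hs | hs
    · rw [hs] at hin; have := ω.2.nth_inj (show l ≤ n by omega) le_rfl (hin.symm.trans e).symm.symm; omega
    · rw [hs] at hout; have := ω.2.nth_inj (show l + 1 ≤ n by omega) le_rfl (hout.symm.trans e).symm.symm; omega
  -- the last plaquette: `ω.1 = N`: `L = (r.1, r.2 + 1)`, left through `S`; `ω.1 = S`: `L = (r.1, r.2 − 1)`, left through `N`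
  have hLcases : (ω.1 = .N ∧ ω.2.sOut (n - 1) = .S ∧ ω.2.fc (n - 1) = (r.1, r.2 + 1)) ∨
      (ω.1 = .S ∧ ω.2.sOut (n - 1) = .N ∧ ω.2.fc (n - 1) = (r.1, r.2 - 1)) := by
    rcases hfc : ω.2.fc (n - 1) with ⟨x, y⟩
    rw [hfc] at hzside hlastr
    rcases r with ⟨r1, r2⟩
    simp only at hlastr ⊢
    generalize hs : ω.2.sOut (n - 1) = s at hzside hlast ⊢
    generalize ht : ω.1 = t at hzside hz ⊢
    rcases hz with rfl | rfl <;> rcases hlast with rfl | rfl <;>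
      simp only [Face.side, MidEdge.slant.injEq, Prod.mk.injEq, reduceCtorEq, false_and, and_false, true_and, false_or, or_false] at hzside ⊢
    · exact absurd (Prod.ext hzside.1 (by simp only; omega)) hlastr
    · refine ⟨?_, ?_⟩ <;> omega
    · refine ⟨?_, ?_⟩ <;> omega
    · exact absurd (Prod.ext hzside.1 (by simp only; omega)) hlastr
  ---------------------------------------------------------------- isolated turns: seven, as `P`-cells
  have h7 : cfgCount ω.2.mids [.corner] + cfgCount ω.2.mids [.coCorner] = 7 := by
    have hcost : cost (slotOfSide ω.1) ω.2.mids =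
        cfgCount ω.2.mids [.corner] + cfgCount ω.2.mids [.coCorner] + (1 - slotDeg (slotOfSide ω.1)) := rfl
    have hd : slotDeg (slotOfSide ω.1) = 1 := by rcases hz with e | e <;> rw [e] <;> rfl
    rw [hcost, hd] at hc; omega
  let P : Face → Prop := fun f => f ∈ facesL ω.2.mids ∧ (kindsL ω.2.mids f = [.corner] ∨ kindsL ω.2.mids f = [.coCorner])
  have hPiso : ∀ k < n, (∀ l < n, ω.2.fc l = ω.2.fc k → l = k) → arcKind (ω.2.sIn k) (ω.2.sOut k) ≠ .straight → P (ω.2.fc k) :=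
    fun k hk hsv hkind => isolated_turn hk hsv hkind
  have hle7 : ∀ T : Finset Face, (∀ f ∈ T, P f) → T.card ≤ 7 := by
    intro T hT; have := YBWalk.card_le_cfgCount_add ω.2.mids T hT; omega
  -- top and bottom turns
  obtain ⟨Y, hYw, hY, Tt, hTtP, hTtrow, hTtcard⟩ := two_top_turns hh hr h hA
  have hTt2 : 1 < Tt.card := by
    rcases hTtcard with h2 | ⟨-, hzv, -⟩
    · omega
    · exfalso; rcases hz with e | e <;> rcases hzv with e' | e' <;> rw [e] at e' <;> exact absurd e' (by decide)
  obtain ⟨t₁, ht₁, t₂, ht₂, ht12⟩ := Finset.one_lt_card.1 hTt2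
  have hPt₁ : P t₁ := hTtP t₁ ht₁
  have hPt₂ : P t₂ := hTtP t₂ ht₂
  have ht₁row : t₁.2 = Y := hTtrow t₁ ht₁
  have ht₂row : t₂.2 = Y := hTtrow t₂ ht₂
  obtain ⟨Y', hY'w, hY', Tb, hTbP, hTbrow, hTbcard⟩ := two_bottom_turns hh hr h hA
  have hTb2 : 1 < Tb.card := by
    rcases hTbcard with h2 | ⟨-, hzv, -⟩
    · omega
    · exfalso; rcases hz with e | e <;> rcases hzv with e' | e' <;> rw [e] at e' <;> exact absurd e' (by decide)
  obtain ⟨b₁, hb₁, b₂, hb₂, hb12⟩ := Finset.one_lt_card.1 hTb2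
  have hPb₁ : P b₁ := hTbP b₁ hb₁
  have hPb₂ : P b₂ := hTbP b₂ hb₂
  have hb₁row : b₁.2 = Y' := hTbrow b₁ hb₁
  have hb₂row : b₂.2 = Y' := hTbrow b₂ hb₂
  have hNtop := forall_top_ne_N hh hr h hY (by omega)
  obtain ⟨X', -, hX', -⟩ := exists_right_entry_turn hh hr h
  obtain ⟨X, hXw, hX, -⟩ := exists_left_entry_turn hh hr h hA
  have hrY : r.2 ≤ Y := by have := hY _ hF; rwa [hfcF] at this
  ---------------------------------------------------------------- the first turn and the root-row turn `τ = (τ1, w.2)`, `τ1 ≥ w.1`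
  have hexk : ∃ k, k < n ∧ arcKind (ω.2.sIn k) (ω.2.sOut k) ≠ .straight := by
    by_contra hnone
    push Not at hnone
    obtain ⟨hrun0, -⟩ := ω.2.initial_run hh hF (fun i hi => hnone i (by omega))
    have e := (hrun0 ω.2.firstHitG le_rfl).1
    rw [hfcF] at e
    have := congrArg Prod.snd e; simp only at this; omega
  obtain ⟨hk₁, hk₁ns⟩ := Nat.find_spec hexk
  set k₁ := Nat.find hexk with hk₁def
  have hstr : ∀ i < k₁, arcKind (ω.2.sIn i) (ω.2.sOut i) = .straight := by
    intro i hi; by_contra hne; exact Nat.find_min hexk hi ⟨by omega, hne⟩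
  obtain ⟨hrun, -⟩ := ω.2.initial_run hh hk₁ hstr
  obtain ⟨hfk, hWk⟩ := hrun k₁ le_rfl
  have hp₁W : ω.2.UsesSide (w.1 + k₁, w.2) .W := ⟨k₁, hk₁, hfk, Or.inl hWk⟩
  obtain ⟨τ1, hPτ, hτ1w⟩ : ∃ τ1 : ℤ, P (τ1, w.2) ∧ w.1 + k₁ ≤ τ1 := by
    by_cases hpE : ω.2.UsesSide (w.1 + k₁, w.2) .E
    · obtain ⟨M, hWall, -, hend⟩ := ω.2.chain_E hX' hpE
      rcases hend with ⟨hM1, hnot⟩ | ⟨-, hs0⟩ | ⟨-, hsZ⟩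
      · obtain ⟨i', hi', hfc', hsv', -, -, -, hk'⟩ := ω.2.isolated_of_usesSide_not_opp (hWall M hM1 le_rfl) hnot
        refine ⟨w.1 + k₁ + M, ?_, by omega⟩
        have := hPiso i' hi' hsv' hk'; rw [hfc'] at this; exact this
      · exact absurd hs0 h0E
      · exact absurd hsZ hzE
    · obtain ⟨i', hi', hfc', hsv', -, -, -, hk'⟩ := ω.2.isolated_of_usesSide_not_opp hp₁W hpE
      refine ⟨w.1 + k₁, ?_, le_rfl⟩
      have := hPiso i' hi' hsv' hk'; rw [hfc'] at this; exact this
  -- `r` is not in the top row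
  have hrtop : r.2 ≠ Y := by
    obtain ⟨j, hj, hjr⟩ := hup
    have := hY j hj
    omega
  have hr₂ : Y' < r.2 := by omega
  have hr₃ : r.2 < Y := lt_of_le_of_ne hrY hrtop
  ---------------------------------------------------------------- the arc of `r` is horizontal: `r` uses `W` and `E`; the ends `e_W`, `e_E` of its chains are isolated turns on the row of `r`
  have hrWE : ω.2.UsesSide r .W ∧ ω.2.UsesSide r .E := by
    have hne := ω.2.sIn_ne_sOut hF
    have hnoz : ¬(ω.2.sIn ω.2.firstHitG = ω.1 ∨ ω.2.sOut ω.2.firstHitG = ω.1) := fun hs => hrside ω.1 ⟨_, hF, hfcF, hs⟩ rfl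
    have key : ∀ t : Side, (t = .N ∨ t = .S) → ¬(ω.2.sIn ω.2.firstHitG = t ∨ ω.2.sOut ω.2.firstHitG = t) →
        arcKind (ω.2.sIn ω.2.firstHitG) (ω.2.sOut ω.2.firstHitG) = .straight → ω.2.sIn ω.2.firstHitG ≠ ω.2.sOut ω.2.firstHitG →
        (ω.2.sIn ω.2.firstHitG = .W ∨ ω.2.sOut ω.2.firstHitG = .W) ∧ (ω.2.sIn ω.2.firstHitG = .E ∨ ω.2.sOut ω.2.firstHitG = .E) := by
      intro t ht
      cases ω.2.sIn ω.2.firstHitG <;> cases ω.2.sOut ω.2.firstHitG <;> rcases ht with rfl | rfl <;> decide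
    obtain ⟨hW, hE⟩ := key ω.1 hz hnoz hstr8 hne
    exact ⟨⟨_, hF, hfcF, hW⟩, ⟨_, hF, hfcF, hE⟩⟩
  obtain ⟨hrW, hrE⟩ := hrWE
  obtain ⟨MW, hEW, -, hendW⟩ := ω.2.chain_W hX hrW
  obtain ⟨hMW1, hPeW⟩ : 1 ≤ MW ∧ P (r.1 - MW, r.2) := by
    rcases hendW with ⟨hM1, hnot⟩ | ⟨hA0, -⟩ | ⟨-, hsZ⟩
    · obtain ⟨i', hi', hfc', hsv', -, -, -, hk'⟩ := ω.2.isolated_of_usesSide_not_opp (hEW MW hM1 le_rfl) hnot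
      refine ⟨hM1, ?_⟩
      have := hPiso i' hi' hsv' hk'; rw [hfc'] at this; exact this
    · exfalso; rw [h0w] at hA0; have := congrArg Prod.snd hA0; simp only at this; omega
    · exact absurd hsZ hzW
  obtain ⟨ME, hWE, -, hendE⟩ := ω.2.chain_E hX' hrE
  obtain ⟨hME1, hPeE⟩ : 1 ≤ ME ∧ P (r.1 + ME, r.2) := by
    rcases hendE with ⟨hM1, hnot⟩ | ⟨-, hs0⟩ | ⟨-, hsZ⟩
    · obtain ⟨i', hi', hfc', hsv', -, -, -, hk'⟩ := ω.2.isolated_of_usesSide_not_opp (hWE ME hM1 le_rfl) hnot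
      refine ⟨hM1, ?_⟩
      have := hPiso i' hi' hsv' hk'; rw [hfc'] at this; exact this
    · exact absurd hs0 h0E
    · exact absurd hsZ hzE
  ---------------------------------------------------------------- an eighth isolated turn strictly between the extreme rows, off the root row and off the row of `r`, is impossible
  have hne_of_row : ∀ f g : Face, f.2 ≠ g.2 → f ≠ g := fun f g hfg e => hfg (by rw [e])
  have houts1 : ∀ g : Face, P g → Y' < g.2 → g.2 < Y → g.2 ≠ w.2 → g.2 ≠ r.2 → False := by
    intro g hPg a1 a2 a3 a4
    have n1 : g ≠ t₁ := hne_of_row _ _ (by rw [ht₁row]; omega)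
    have n2 : g ≠ t₂ := hne_of_row _ _ (by rw [ht₂row]; omega)
    have n3 : g ≠ b₁ := hne_of_row _ _ (by rw [hb₁row]; omega)
    have n4 : g ≠ b₂ := hne_of_row _ _ (by rw [hb₂row]; omega)
    have n5 : g ≠ ((τ1 : ℤ), w.2) := hne_of_row _ _ (by simp only; exact a3)
    have n6 : g ≠ ((r.1 : ℤ) - MW, r.2) := hne_of_row _ _ (by simp only; exact a4)
    have n7 : g ≠ ((r.1 : ℤ) + ME, r.2) := hne_of_row _ _ (by simp only; exact a4)
    have h01 : t₁ ≠ t₂ := ht12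
    have h02 : t₁ ≠ b₁ := hne_of_row _ _ (by rw [ht₁row, hb₁row]; omega)
    have h03 : t₁ ≠ b₂ := hne_of_row _ _ (by rw [ht₁row, hb₂row]; omega)
    have h04 : t₁ ≠ ((τ1 : ℤ), w.2) := hne_of_row _ _ (by rw [ht₁row]; simp only; omega)
    have h05 : t₁ ≠ ((r.1 : ℤ) - MW, r.2) := hne_of_row _ _ (by rw [ht₁row]; simp only; omega)
    have h06 : t₁ ≠ ((r.1 : ℤ) + ME, r.2) := hne_of_row _ _ (by rw [ht₁row]; simp only; omega)
    have h12 : t₂ ≠ b₁ := hne_of_row _ _ (by rw [ht₂row, hb₁row]; omega)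
    have h13 : t₂ ≠ b₂ := hne_of_row _ _ (by rw [ht₂row, hb₂row]; omega)
    have h14 : t₂ ≠ ((τ1 : ℤ), w.2) := hne_of_row _ _ (by rw [ht₂row]; simp only; omega)
    have h15 : t₂ ≠ ((r.1 : ℤ) - MW, r.2) := hne_of_row _ _ (by rw [ht₂row]; simp only; omega)
    have h16 : t₂ ≠ ((r.1 : ℤ) + ME, r.2) := hne_of_row _ _ (by rw [ht₂row]; simp only; omega)
    have h23 : b₁ ≠ b₂ := hb12
    have h24 : b₁ ≠ ((τ1 : ℤ), w.2) := hne_of_row _ _ (by rw [hb₁row]; simp only; omega)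
    have h25 : b₁ ≠ ((r.1 : ℤ) - MW, r.2) := hne_of_row _ _ (by rw [hb₁row]; simp only; omega)
    have h26 : b₁ ≠ ((r.1 : ℤ) + ME, r.2) := hne_of_row _ _ (by rw [hb₁row]; simp only; omega)
    have h34 : b₂ ≠ ((τ1 : ℤ), w.2) := hne_of_row _ _ (by rw [hb₂row]; simp only; omega)
    have h35 : b₂ ≠ ((r.1 : ℤ) - MW, r.2) := hne_of_row _ _ (by rw [hb₂row]; simp only; omega)
    have h36 : b₂ ≠ ((r.1 : ℤ) + ME, r.2) := hne_of_row _ _ (by rw [hb₂row]; simp only; omega)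
    have h45 : ((τ1 : ℤ), w.2) ≠ ((r.1 : ℤ) - MW, r.2) := hne_of_row _ _ (by simp only; omega)
    have h46 : ((τ1 : ℤ), w.2) ≠ ((r.1 : ℤ) + ME, r.2) := hne_of_row _ _ (by simp only; omega)
    have h56 : ((r.1 : ℤ) - MW, r.2) ≠ ((r.1 : ℤ) + ME, r.2) := by intro e; have := congrArg Prod.fst e; simp only at this; omega
    have hT : ∀ f ∈ ({g, t₁, t₂, b₁, b₂, ((τ1 : ℤ), w.2), ((r.1 : ℤ) - MW, r.2), ((r.1 : ℤ) + ME, r.2)} : Finset Face), P f := by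
      intro f hf
      simp only [Finset.mem_insert, Finset.mem_singleton] at hf
      rcases hf with rfl | rfl | rfl | rfl | rfl | rfl | rfl | rfl
      exacts [hPg, hPt₁, hPt₂, hPb₁, hPb₂, hPτ, hPeW, hPeE]
    have hcard : ({g, t₁, t₂, b₁, b₂, ((τ1 : ℤ), w.2), ((r.1 : ℤ) - MW, r.2), ((r.1 : ℤ) + ME, r.2)} : Finset Face).card = 8 := by
      rw [Finset.card_insert_of_notMem (by simp only [Finset.mem_insert, Finset.mem_singleton, not_or]; exact ⟨n1, n2, n3, n4, n5, n6, n7⟩),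
        Finset.card_insert_of_notMem (by simp only [Finset.mem_insert, Finset.mem_singleton, not_or]; exact ⟨h01, h02, h03, h04, h05, h06⟩),
        Finset.card_insert_of_notMem (by simp only [Finset.mem_insert, Finset.mem_singleton, not_or]; exact ⟨h12, h13, h14, h15, h16⟩),
        Finset.card_insert_of_notMem (by simp only [Finset.mem_insert, Finset.mem_singleton, not_or]; exact ⟨h23, h24, h25, h26⟩),
        Finset.card_insert_of_notMem (by simp only [Finset.mem_insert, Finset.mem_singleton, not_or]; exact ⟨h34, h35, h36⟩),
        Finset.card_insert_of_notMem (by simp only [Finset.mem_insert, Finset.mem_singleton, not_or]; exact ⟨h45, h46⟩),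
        Finset.card_insert_of_notMem (by simp only [Finset.mem_singleton]; exact h56), Finset.card_singleton]
    have := hle7 _ hT
    omega
  ---------------------------------------------------------------- the root-row plaquette met by the excursion from below
  have hk₁F : k₁ ≤ ω.2.firstHitG := by
    by_contra hlt
    push Not at hlt
    obtain ⟨hrun0, -⟩ := ω.2.initial_run hh hF (fun i hi => hstr i (by omega))
    have e := (hrun0 ω.2.firstHitG le_rfl).1
    rw [hfcF] at e
    have := congrArg Prod.snd e; simp only at this; omega
  have hwr : r.1 < w.1 := by omega
  obtain ⟨i, hFi, hin, hki, hrow, hS⟩ := exists_tail_arc_rootRow_S_beyond_prefix hh hr h hA hwr hk₁F hstr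
  refine ⟨k₁, i, hk₁F, hstr, hk₁ns, hfk, hWk, hFi, hin, hrow, hki, hS, ?_⟩
  rcases eq_or_lt_of_le hki with heq | hlt
  · ---------------------------------------------------------------- (I) the kiss at the first turning plaquette
    left
    have hqp : ω.2.fc i = ω.2.fc k₁ := by rw [hfk]; exact Prod.ext heq.symm hrow
    have hik : k₁ ≠ i := by omega
    obtain ⟨hno, h1, h2, h3, h4⟩ := YBWalk.not_straight_of_two_arcs (γ := ω.2) (i := k₁) (i' := i) hk₁ hin hik hqp
    rw [hWk] at h1 h3
    have hnek := ω.2.sIn_ne_sOut hk₁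
    have hnei := ω.2.sIn_ne_sOut hin
    rw [hWk] at hnek
    have hkns := hk₁ns
    rw [hWk] at hkns
    have hN : ω.2.sOut k₁ = .N := by
      have hnS : ω.2.sOut k₁ ≠ .S := by
        rcases hS with e | e
        · rw [← e]; exact Ne.symm h2
        · rw [← e]; exact Ne.symm h4
      revert hnek hkns hnS
      cases ω.2.sOut k₁ <;> decide
    refine ⟨hqp, hN, ?_⟩
    rw [hN] at h2 h4
    revert h1 h2 h3 h4 hnei hS
    cases ω.2.sIn i <;> cases ω.2.sOut i <;> decide
  · right
    by_cases hstq : arcKind (ω.2.sIn i) (ω.2.sOut i) = .straight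
    · ---------------------------------------------------------------- (II) a straight crossing strictly east of the first turn
      left
      have hsv : ∀ l < n, ω.2.fc l = ω.2.fc i → l = i := by
        intro l hl e
        by_contra hne
        obtain ⟨hno, -⟩ := YBWalk.not_straight_of_two_arcs (γ := ω.2) (i := i) (i' := l) hin hl (Ne.symm hne) e
        have key : ∀ s t : Side, arcKind s t = .straight → t = s.opp := by intro s t; cases s <;> cases t <;> decide
        exact hno (key _ _ hstq)
      have hqN : ω.2.UsesSide (ω.2.fc i) .N := by
        have key : ∀ s t : Side, arcKind s t = .straight → (s = .S ∨ t = .S) → (s = .N ∨ t = .N) := by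
          intro s t; cases s <;> cases t <;> decide
        exact ⟨i, hin, rfl, key _ _ hstq hS⟩
      obtain ⟨M, hSall', hNall', hend'⟩ := ω.2.chain_N hY hqN
      rw [hrow] at hSall' hNall' hend'
      refine ⟨hlt, hstq, hsv, M, ?_⟩
      rcases hend' with ⟨hM1, hnot⟩ | ⟨hZ0, hs0⟩ | ⟨hZ, hsZ⟩
      · refine ⟨hM1, hSall', hNall', hnot, ?_⟩
        obtain ⟨i', hi', hfc', hsv', -, -, -, hk'⟩ := ω.2.isolated_of_usesSide_not_opp (hSall' M hM1 le_rfl) hnot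
        have hP' : P ((ω.2.fc i).1, w.2 + M) := by rw [← hfc']; exact hPiso i' hi' hsv' hk'
        have hle : w.2 + M ≤ Y := by have := hY i' hi'; rw [hfc'] at this; exact this
        by_cases hr2 : w.2 + (M : ℤ) = r.2
        · exact Or.inl hr2
        · right
          rcases lt_or_eq_of_le hle with hlt' | heq'
          · exfalso
            exact houts1 _ hP' (by simp only; omega) (by simp only; exact hlt') (by simp only; omega) (by simp only; exact hr2)
          · intro j hj; have := hY j hj; omega
      · exact absurd hs0 h0N
      · exfalso
        rcases hLcases with ⟨-, hsS, -⟩ | ⟨-, -, hL⟩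
        · rw [hsS] at hsZ; exact absurd hsZ (by decide)
        · rw [hL] at hZ; have := congrArg Prod.fst hZ; simp only at this; omega
    · ---------------------------------------------------------------- (III) the residual turning case
      right
      exact ⟨hlt, hstq⟩

end ΩG

end Literature.Probability.RandomPlanarGeometry.SAW.YangBaxter
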